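import Literature.Algebra.EuclideanLattices.DualGridAttemptSuccess
import Literature.Algebra.EuclideanLattices.GapSVPFromDualSets
import Literature.Computability.Cryptography.GapSVPFromShortDualSets
import Mathlib.Data.Real.Pointwise
import HarnessLib

/-!
# From the stopped loop to `λ₁`-short dual sets: `Λ = Dg · L(B)*`, the scaling of the smoothing parameter, and the output quality

Topic `Algebra/EuclideanLattices` (family `pqc`). The last mathematical step of the machine behind
`Literature.Computability.Cryptography.owfExist_of_gapSVP_worstCaseHard` (seat B): the loop of
the Lemma 5.10 loop stops with rows `sⱼ ∈ Λ = G ℤⁿ`, independent, of norm `≤ C √n η_ε(Λ)`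
(a loop of Lemma 5.10 type stops with `‖S‖ ≤ C √n η`); the machine outputs `(D, U) = (Dg, S)`, and this must be a member of
`shortDualOutputs ⟨n, B⟩ g` of `GapSVPFromShortDualSets` (rows `uᵢ/D ∈ L(B)*`, independent,
`‖uᵢ/D‖ · λ₁(L(B)) ≤ g`). Proved here:

* `smul_mem_dualLattice_of_mem_dualLat`, `mem_dualLat_of_smul_mem_dualLattice` —
  **`Λ = Dg · L(B)*`** exactly (`⟪G z/Dg, bᵢ⟫ = zᵢ`; conversely a vector pairing integrally with the
  rows `bᵢ`, which span `ℝⁿ`, is `G w` for the integer vector `w` of pairings);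
* `mem_dualLattice_iff_of_scaled`, `gaussianMass_inv_smul`, **`smoothingParameter_eq_mul_of_scaled`**
  — for `Λ = c · L` (`c > 0`): `Λ* = c⁻¹ L*` and **`η_ε(Λ) = c · η_ε(L)`** (MR07 Def. 3.1 is
  homogeneous of degree one; from the definition as an infimum and `ρ_{1/s}(c⁻¹y) = ρ_{c/s}(y)`);
  hence `smoothingParameter_dualLat` : `η_ε(Λ) = Dg · η_ε(L(B)*)`;
* **`mem_shortDualOutputs_of_short`** — if the rows of `S` lie in `Λ`, are independent and have
  norms `≤ C √n · η_{2⁻ⁿ}(Λ)`, then `boolPair (encodeNat Dg) (encode ⟨n, S⟩) ∈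
  shortDualOutputs ⟨n, B⟩ (C n)` (`norm_mul_minNorm_le_of_le_smoothing`: `η_{2⁻ⁿ}(L*)·λ₁(L) ≤ √n`,
  MR07 Lemma 3.2 for the dual).

## References

* D. Micciancio, O. Regev, *Worst-case to average-case reductions based on Gaussian measures*,
  SIAM J. Comput. 37 (2007) 267–302; authors' version, Def. 3.1 (p. 11), Lemma 3.2, Cor. 5.13,
  Thm. 5.23 (proof, first step, p. 29).
* D. Micciancio, S. Goldwasser, *Complexity of Lattice Problems*, Kluwer 2002, Ch. 1 §1
  (`L(B)* = L((B⁻¹)ᵀ)`) [MicciancioGoldwasser2002].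
-/

noncomputable section

open scoped Classical Pointwise ENNReal RealInnerProductSpace

namespace Literature.Algebra.EuclideanLattices

open Module Submodule Matrix Finset GSInverse Literature.Computability.Cryptography
  _root_.Computability Literature.Computability.Complexity

namespace DualGrid

variable {n : ℕ}

/-! ### `Λ = Dg · L(B)*` -/

/-- **`Λ/Dg ⊆ L(B)*`.** [cite: MicciancioGoldwasser2002, Ch. 1 §1] -/
theorem smul_mem_dualLattice_of_mem_dualLat {B : Matrix (Fin n) (Fin n) ℤ} (hB : B.det ≠ 0) {x : EuclideanSpace ℝ (Fin n)}
    (hx : x ∈ dualLat B) : ((Dg B : ℤ) : ℝ)⁻¹ • x ∈ dualLattice ((⟨n, B⟩ : LatticeInstance).lattice) := by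
  obtain ⟨z, rfl⟩ := (mem_dualLat_iff B x).1 hx
  rw [mem_dualLattice]
  intro y hy
  obtain ⟨w, rfl⟩ := ((⟨n, B⟩ : LatticeInstance).mem_lattice_iff y).1 hy
  refine ⟨∑ i, w i * z i, ?_⟩
  rw [LatticeInstance.ofCoeffs_eq_sum, inner_sum]
  push_cast
  refine Finset.sum_congr rfl fun i _ => ?_
  rw [← Int.cast_smul_eq_zsmul ℝ, real_inner_smul_right, inner_G_mulVec_vec hB]

/-- **`Dg · L(B)* ⊆ Λ`**: a vector whose pairings with the rows of `B` after division by `Dg` are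
integers is `G w`. [cite: MicciancioGoldwasser2002, Ch. 1 §1] -/
theorem mem_dualLat_of_smul_mem_dualLattice {B : Matrix (Fin n) (Fin n) ℤ} (hB : B.det ≠ 0) {x : EuclideanSpace ℝ (Fin n)}
    (hx : ((Dg B : ℤ) : ℝ)⁻¹ • x ∈ dualLattice ((⟨n, B⟩ : LatticeInstance).lattice)) : x ∈ dualLat B := by
  set I : LatticeInstance := ⟨n, B⟩ with hI
  rw [mem_dualLattice] at hx
  choose w hw using fun i => hx (I.vec i) (subset_span (Set.mem_range_self i))
  -- `x' = G w` has the same pairings; the rows span `ℝⁿ`, so `x = x'`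
  set x' : EuclideanSpace ℝ (Fin n) := intVecToEuclidean n (G B *ᵥ w) with hx'
  have hpair : ∀ i, ⟪((Dg B : ℤ) : ℝ)⁻¹ • (x - x'), I.vec i⟫ = 0 := fun i => by
    rw [smul_sub, inner_sub_left, ← hw i, hx', inner_G_mulVec_vec hB, sub_self]
  have hspan : span ℝ (Set.range I.vec) = ⊤ := (LatticeInstance.isNonsingular_iff_span_range_vec_eq_top I).1 hB
  have horth : ((Dg B : ℤ) : ℝ)⁻¹ • (x - x') ∈ (span ℝ (Set.range I.vec))ᗮ := by
    rw [Submodule.mem_orthogonal]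
    intro u hu
    refine Submodule.span_induction (p := fun u _ => ⟪u, ((Dg B : ℤ) : ℝ)⁻¹ • (x - x')⟫ = 0) ?_ ?_ ?_ ?_ hu
    · rintro _ ⟨i, rfl⟩; rw [real_inner_comm]; exact hpair i
    · exact inner_zero_left _
    · intro a b _ _ ha hb; rw [inner_add_left, ha, hb, add_zero]
    · intro r a _ ha; rw [real_inner_smul_left, ha, mul_zero]
  rw [hspan, Submodule.top_orthogonal_eq_bot, Submodule.mem_bot, smul_eq_zero] at horth
  rcases horth with h | h
  · exact absurd h (inv_ne_zero (by exact_mod_cast (Dg_pos hB).ne'))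
  · rw [sub_eq_zero] at h
    rw [h, hx']
    exact G_mulVec_mem_dualLat B w

/-- `x ∈ Λ ⇔ Dg⁻¹ x ∈ L(B)*`. [cite: MicciancioGoldwasser2002, Ch. 1 §1] -/
theorem mem_dualLat_iff_smul_mem {B : Matrix (Fin n) (Fin n) ℤ} (hB : B.det ≠ 0) (x : EuclideanSpace ℝ (Fin n)) :
    x ∈ dualLat B ↔ ((Dg B : ℤ) : ℝ)⁻¹ • x ∈ dualLattice ((⟨n, B⟩ : LatticeInstance).lattice) :=
  ⟨smul_mem_dualLattice_of_mem_dualLat hB, mem_dualLat_of_smul_mem_dualLattice hB⟩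

/-! ### The smoothing parameter scales -/

section Scaling

variable {E : Type*} [NormedAddCommGroup E] [InnerProductSpace ℝ E]

/-- For `Λ = c L`: `y ∈ Λ* ⇔ c y ∈ L*`. [cite: MicciancioRegev2007, §2 (dual of a scaled lattice)] -/
theorem mem_dualLattice_iff_of_scaled {Λ L : Submodule ℤ E} {c : ℝ} (hc : c ≠ 0) (h : ∀ x, x ∈ Λ ↔ c⁻¹ • x ∈ L) (y : E) :
    y ∈ dualLattice Λ ↔ c • y ∈ dualLattice L := by
  rw [mem_dualLattice, mem_dualLattice]
  constructor
  · intro hy x' hx'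
    obtain ⟨k, hk⟩ := hy (c • x') ((h _).2 (by rwa [smul_smul, inv_mul_cancel₀ hc, one_smul]))
    exact ⟨k, by rw [hk, real_inner_smul_left, real_inner_smul_right]⟩
  · intro hy x hx
    obtain ⟨k, hk⟩ := hy (c⁻¹ • x) ((h x).1 hx)
    exact ⟨k, by rw [hk, real_inner_smul_left, real_inner_smul_right, ← mul_assoc, mul_inv_cancel₀ hc, one_mul]⟩

/-- For `Λ = c L`: `Λ* ∖ 0 = c⁻¹ (L* ∖ 0)`. [folklore] -/
theorem dualLattice_diff_eq_smul_of_scaled {Λ L : Submodule ℤ E} {c : ℝ} (hc : c ≠ 0) (h : ∀ x, x ∈ Λ ↔ c⁻¹ • x ∈ L) :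
    (dualLattice Λ : Set E) \ {0} = c⁻¹ • ((dualLattice L : Set E) \ {0}) := by
  ext y
  rw [Set.mem_smul_set]
  constructor
  · rintro ⟨hy, hy0⟩
    refine ⟨c • y, ⟨(mem_dualLattice_iff_of_scaled hc h y).1 hy, ?_⟩, by rw [smul_smul, inv_mul_cancel₀ hc, one_smul]⟩
    simpa [smul_eq_zero, hc] using hy0
  · rintro ⟨z, ⟨hz, hz0⟩, rfl⟩
    refine ⟨(mem_dualLattice_iff_of_scaled hc h _).2 (by rwa [smul_smul, mul_inv_cancel₀ hc, one_smul]), ?_⟩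
    simpa [smul_eq_zero, hc] using hz0

/-- `ρ_{1/s}(c⁻¹ T) = ρ_{1/(s/c)}(T)` (Gaussian masses scale; cf. `gaussianMass_smul_set` in
`RegevQuantumPart`, restated here for the inverse scaling to keep the import closure small). [cite: MicciancioRegev2007, §2] -/
theorem gaussianMass_inv_smul {c : ℝ} (hc : c ≠ 0) (s : ℝ) (T : Set E) :
    gaussianMass (1 / s) 0 (c⁻¹ • T) = gaussianMass (1 / (s / c)) 0 T := by
  unfold gaussianMass
  have hinj : Function.Injective fun x : E => c⁻¹ • x := smul_right_injective E (inv_ne_zero hc)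
  rw [← Set.image_smul, ← (Equiv.Set.image (fun x : E => c⁻¹ • x) T hinj).tsum_eq]
  refine tsum_congr fun x => ?_
  simp only [Equiv.Set.image_apply, sub_zero]
  rw [show (1 : ℝ) / s = c⁻¹ * (1 / (s / c)) by field_simp, gaussianFunction_smul _ (inv_ne_zero hc)]

/-- **The smoothing parameter is homogeneous**: for `Λ = c L` with `c > 0`, `η_ε(Λ) = c · η_ε(L)`.
[cite: MicciancioRegev2007, Def. 3.1 (p. 11)] -/
theorem smoothingParameter_eq_mul_of_scaled {Λ L : Submodule ℤ E} {c : ℝ} (hc : 0 < c) (h : ∀ x, x ∈ Λ ↔ c⁻¹ • x ∈ L) (ε : ℝ) :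
    smoothingParameter Λ ε = c * smoothingParameter L ε := by
  rw [smoothingParameter, smoothingParameter, ← smul_eq_mul, ← Real.sInf_smul_of_nonneg hc.le]
  congr 1
  ext s
  rw [Set.mem_smul_set]
  simp only [Set.mem_setOf_eq]
  rw [dualLattice_diff_eq_smul_of_scaled hc.ne' h, gaussianMass_inv_smul hc.ne']
  constructor
  · rintro ⟨hs, hm⟩
    exact ⟨s / c, ⟨div_pos hs hc, hm⟩, by rw [smul_eq_mul, mul_div_cancel₀ _ hc.ne']⟩
  · rintro ⟨s', ⟨hs', hm⟩, rfl⟩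
    rw [smul_eq_mul]
    exact ⟨mul_pos hc hs', by rwa [mul_div_cancel_left₀ _ hc.ne']⟩

end Scaling

/-- **`η_ε(Λ) = Dg · η_ε(L(B)*)`.** [cite: MicciancioRegev2007, Def. 3.1 with MicciancioGoldwasser2002 Ch. 1 §1] -/
theorem smoothingParameter_dualLat {B : Matrix (Fin n) (Fin n) ℤ} (hB : B.det ≠ 0) (ε : ℝ) :
    smoothingParameter (dualLat B) ε = (Dg B : ℝ) * smoothingParameter (dualLattice ((⟨n, B⟩ : LatticeInstance).lattice)) ε :=
  smoothingParameter_eq_mul_of_scaled (by exact_mod_cast Dg_pos hB) (fun x => by exact_mod_cast mem_dualLat_iff_smul_mem hB x) ε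

/-! ### The output is a `λ₁`-short dual set -/

/-- **From the stopped loop to `shortDualOutputs`**: if the rows of `S` lie in `Λ`, are linearly
independent, and all have norm `≤ C √n · η_{2⁻ⁿ}(Λ)`, then `(Dg, S)` encodes a member of
`shortDualOutputs ⟨n, B⟩ (C n)`: `sⱼ/Dg ∈ L(B)*`, independent, and
`‖sⱼ/Dg‖ · λ₁(L(B)) ≤ C √n · η_{2⁻ⁿ}(L(B)*) · λ₁(L(B)) ≤ C n` (MR07 Lemma 3.2 for the dual).
[cite: MicciancioRegev2007, Cor. 5.13 with Thm. 5.23 (proof, first step, p. 29) and Lemma 3.2] -/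
theorem mem_shortDualOutputs_of_short {B : Matrix (Fin n) (Fin n) ℤ} (hB : B.det ≠ 0) (hn : 1 ≤ n) {C : ℝ} (hC : 0 ≤ C)
    {S : Matrix (Fin n) (Fin n) ℤ} (hS : ∀ j, intVecToEuclidean n (S j) ∈ dualLat B)
    (hli : LinearIndependent ℝ fun j => intVecToEuclidean n (S j))
    (hshort : ∀ j, ‖intVecToEuclidean n (S j)‖ ≤ C * Real.sqrt n * smoothingParameter (dualLat B) ((2⁻¹ : ℝ) ^ n)) :
    boolPair (encodeNat (Dg B).toNat) (LatticeInstance.encode ⟨n, S⟩) ∈ shortDualOutputs ⟨n, B⟩ (C * n) := by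
  have hDg : ((Dg B).toNat : ℝ) = (Dg B : ℝ) := by exact_mod_cast Int.toNat_of_nonneg (Dg_pos hB).le
  have hDpos : 0 < (Dg B).toNat := by have := Dg_pos hB; omega
  haveI : DiscreteTopology ((⟨n, B⟩ : LatticeInstance).lattice) := LatticeInstance.instDiscreteTopologyLattice ⟨n, B⟩
  haveI : IsZLattice ℝ ((⟨n, B⟩ : LatticeInstance).lattice) := LatticeInstance.isZLattice_of_isNonsingular (I := ⟨n, B⟩) hB
  haveI : Nontrivial (EuclideanSpace ℝ (Fin n)) := by
    haveI : Nonempty (Fin n) := ⟨⟨0, hn⟩⟩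
    infer_instance
  refine ⟨(Dg B).toNat, S, rfl, hDpos, fun i => ?_, hli, fun i => ?_⟩
  · rw [hDg]; exact smul_mem_dualLattice_of_mem_dualLat hB (hS i)
  · rw [hDg]
    have hx : ‖((Dg B : ℤ) : ℝ)⁻¹ • intVecToEuclidean n (S i)‖ ≤
        C * Real.sqrt n * smoothingParameter (dualLattice ((⟨n, B⟩ : LatticeInstance).lattice)) ((2⁻¹ : ℝ) ^ finrank ℝ (EuclideanSpace ℝ (Fin n))) := by
      rw [finrank_euclideanSpace_fin, norm_smul, norm_inv, Real.norm_eq_abs, abs_of_pos (by exact_mod_cast Dg_pos hB)]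
      rw [smoothingParameter_dualLat hB] at hshort
      have h := hshort i
      rw [inv_mul_le_iff₀ (by exact_mod_cast Dg_pos hB)]
      linarith
    have h := norm_mul_minNorm_le_of_le_smoothing ((⟨n, B⟩ : LatticeInstance).lattice) (g := C * Real.sqrt n) (by positivity) hx
    rw [finrank_euclideanSpace_fin] at h
    calc ‖((Dg B : ℤ) : ℝ)⁻¹ • intVecToEuclidean n (S i)‖ * minNorm ((⟨n, B⟩ : LatticeInstance).lattice) ≤ C * Real.sqrt n * Real.sqrt n := h
      _ = C * n := by rw [mul_assoc, Real.mul_self_sqrt (by positivity)]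

end DualGrid

end Literature.Algebra.EuclideanLattices

end
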